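import Summits.BirchSwinnertonDyer.Rank1Residual.Additive.QuadraticBranchEvenControlLower
import Summits.BirchSwinnertonDyer.Rank1Residual.Additive.SignedTwistPlusTransverse
import Summits.BirchSwinnertonDyer.Rank1Residual.Additive.StrictSignedPreimageKummerBound
import Literature.NumberTheory.EllipticCurves.BSDSelmerParityDokchitserBaseChangeProofs
import HarnessLib

/-!
# (L0⁺) DISCHARGED: Kobayashi's (9.33) at `n = 0` for the sign `+` on the quadratic branch — the
# level-`∞` PLUS Kummer condition at `ℚ_p` pulls back to the classical one (cell `bsd-potss`, seat
# `bsd-potss-ctrl` g2; TARGET.md v2 §1.1 T-e2-r0, the typed reading `EvenBranchPlusLocalControlZeroAt`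
# of `QuadraticBranchEvenControlLower.lean` becomes a THEOREM)

HONEST FRAMING (cell `bsd-potss`, run/shared/lean/pub/bsd-potss/; FULL-BSD rank ≤ 1 programme,
tranche 1b): THEOREMS ONLY — no definition, no named Literature fact, no Summits-side fact
`def … : Prop`, no `sorry`, axioms standard; UNCONDITIONAL (Tate's local Euler–Poincaré
characteristic is the tree's theorem `localEulerPoincareCharacteristic_holds`, n1011 T-EPC); nothing
is booked; no label / mark / count moves; Gss2 / O5a / O10-PS stay OPEN; (C1_η) stays a hypothesis
of every downstream statement; nothing about `BSD(W, p)` of any pair is claimed here.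

## What

* §1 `LevelBridge.exists_kummer_cocycle_of_mem_localKummerOverOfEmb_iSup_signed_one` — the PLUS
  twin of x1b's file 86 (`…_iSup_strictSigned`, sign `−`): if `h_0(Ψ_m c)` lies in
  `localKummerOverOfEmb W p (ker κ) (closureEmb E) (⨆_n E⁺(K_n·E))` and the tower has no `p`-power
  torsion (Prop. 8.7), then for some layer `n`, plus point `x ∈ E⁺(K_n·E)` and `R` with `p^m R = x`,
  `res_E c ∈ H¹(E, E[p^m])` is represented by a cocycle `u ↦ u•R − R` on `Gal(K̄_E/K_n·E)` (same
  proof; the saturation step is Lemma 8.17 for the sign `+`, which carries no clause).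
* §2 **`evenBranchPlusLocalControlZeroAt_holds : EvenBranchPlusLocalControlZeroAt W p`** for every
  globally minimal elliptic `W/ℚ` and every prime `p` (the statement's own binders make it the
  `p*`-twist of a good `a_p = 0` curve, `p` odd, `κ` cyclotomic). Proof — B3's route, replacing
  Kobayashi's Thm. 6.2 (Coleman maps): a class `y` of `H¹(ℚ_0, W[p^∞])` is `Ψ_m c`
  (`exists_levelToLayerZero_eq_of_nsmul_eq_zero`; `H¹` is `p`-primary); its tower plus condition at
  `ℚ_p` gives a plus Kummer witness `(x ∈ E⁺_W(n₁), R, φ)` for `res_p c` (§1); at the layer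
  `n = max(2m, n₁)` B3 in level-`m` shape (x1b file 98,
  `closure_minus_sup_range_localKummerMap_eq_top_of_localEuler`: `Σ_m ⊔ 𝓚 = H¹(ℚ_p, W[p^m])`) puts
  `res_p c ∈ Σ_m ⊔ 𝓚`, and PLUS TRANSVERSALITY (`SignedTwistPlusTransverse`: Prop. 8.12 ii)
  disjointness on `η`-odd points) forces `res_p c ∈ 𝓚`, i.e. `res_p c` is the Kummer class of a
  point of `W(ℚ_p) = E⁺_W(0)`; x1b's file 85 (`resH1Hom_subgroupIncl_map_mem_localKummerOverOfEmb_of_res_eq`)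
  turns that into the level-`0` plus Kummer condition for `y`.
* §3 `EvenControlZero.finite_and_padicValNat_card_selmerGroupPInfty_le_and_le_of_readings'` —
  file 5's two inequalities `ord_p #Sel_{p^∞}(W/ℚ) ≤ v_p(L_p⁺(V,η,0)) ≤ ord_p #Sel + ord_p(Tam/#tors²)`
  with (L0⁺) DISCHARGED: modulo (R1⁺) + (R2⁺) only.
* §4 **`quadraticBranchEvenExactControlOfPlusMCAt_of_readings_of_not_dvd_tamagawa`** — the TYPED
  T-e2-r0 node `QuadraticBranchEvenExactControlOfPlusMCAt W p` (p401865) HOLDS on the Tamagawa-free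
  rows `p ∤ Tam(W)`, modulo (R1⁺) + (R2⁺) (the two inequalities close up; the `p ∣ Tam` rows need the
  rank-`0` Cassels–Poitou–Tate count, sequel).

References: [Kobayashi2003] S. Kobayashi, Invent. Math. 152 (2003), Def. 1.1 / 2.1 (pp. 2, 5),
Thm. 6.2 (p. 11), Prop. 8.7 (p. 16), Prop. 8.12 ii) (pp. 17–18), Lemma 8.17 (p. 19), Lemma 9.1,
Prop. 9.2 with (9.30)/(9.33), Thm. 9.3 (pp. 25–27); [GreenbergLNM1716] §2 (pp. 62–63), §3
(pp. 85–86); [MilneADT2006] I Thm. 2.8; [SerreGaloisCohomology1997] I.§5.8, II.§1.1.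
-/

noncomputable section

open scoped Classical

open WeierstrassCurve Literature.NumberTheory.EllipticCurves Literature.NumberTheory.GaloisRepresentations
  NumberField IsDedekindDomain Field
open Literature.NumberTheory.EllipticCurves.Kobayashi2003
open Summit.BirchSwinnertonDyer.Rank1Residual.X11b.Levels
open Summit.BirchSwinnertonDyer.Rank1Residual.X11b
open scoped ContRepresentation

/-! ## §1 From the `K_∞`-PLUS condition down to a Kummer cocycle over a finite layer -/

namespace Summit.BirchSwinnertonDyer.Rank1Residual.Additive.LevelBridge

universe u

section Main

variable {K : Type u} [Field K] (W : WeierstrassCurve K) (p : ℕ) [hp : Fact p.Prime] (m : ℕ)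
  (E : Type u) [Field E] [Algebra K E] (κ : ZpExtension K p)

/-- **From the `K_∞`-PLUS condition to a finite layer** (plus twin of x1b's file 86): if
`h_0(Ψ_m c)` lies in `localKummerOverOfEmb W p (ker κ) (closureEmb E) (⨆_n E⁺(K_n·E))`, `E(K_∞·E)`
has no `p`-power torsion and the layers `E(K_n·E)` have no `p`-torsion, then for some layer `n`,
some plus point `x ∈ E⁺(K_n·E)` (`= E^{+,str}`, no clause) and some `R` with `p^m R = x`, the class
`res_E c ∈ H¹(E, E[p^m])` is represented by a cocycle with values `u ↦ u•R − R` on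
`Gal(K̄_E/K_n·E)` (the crossed homomorphism `u ↦ φ₀(u|_K̄) − (uR − R)` vanishes on
`Gal(K̄_E/K_∞·E)`, hence takes `E(K_∞·E)`-values, which are `p`-power torsion on `Gal(K̄_E/K_n·E)`,
hence zero; the root is made a plus point by Lemma 8.17).
[cite: Kobayashi2003, Def. 1.1 (p. 2), Prop. 8.7 (p. 16), Lemma 8.17 (p. 19), §9]
[cite: GreenbergLNM1716, §3 pp. 85–86] -/
theorem exists_kummer_cocycle_of_mem_localKummerOverOfEmb_iSup_signed_one
    (htors : ∀ n, ∀ P ∈ localLayerPointsOfEmb κ (closureEmb (K := K) E) W n, p • P = 0 → P = 0)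
    (htorsInf : ∀ P ∈ localFixedPointsOfEmb (closureEmb (K := K) E) W κ.kerSubgroup,
      ∀ j : ℕ, p ^ j • P = 0 → P = 0)
    (c : galoisCohomology (W.torsionGaloisModule ((p ^ m : ℕ) : ℤ)) 1)
    (hc : resH1Hom (Literature.NumberTheory.EllipticCurves.subgroupIncl κ.kerSubgroup) (AddMonoidHom.id (geomPrimaryTorsion W p))
        (fun _ _ ↦ rfl) (galoisCohomology.map (primaryInclusion W p m) 1 c) ∈
      localKummerOverOfEmb W p κ.kerSubgroup (closureEmb (K := K) E)
        (⨆ n, strictSignedLocalPointsOfEmb κ (closureEmb (K := K) E) W 1 n)) :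
    ∃ n : ℕ, ∃ x ∈ strictSignedLocalPointsOfEmb κ (closureEmb (K := K) E) W 1 n,
      ∃ R : localPoints W E, ((p ^ m : ℕ) : ℤ) • R = x ∧
      ∃ φ : contOneCocycles (DiscreteGaloisModule.toTopRep
          (GaloisRep.restrictField E (W.torsionGaloisModule ((p ^ m : ℕ) : ℤ)))),
        galoisCohomology.res (W.torsionGaloisModule ((p ^ m : ℕ) : ℤ)) E 1 c = oneCocycleClass _ φ ∧
        ∀ u ∈ localLayerSubgroupOfEmb κ (closureEmb (K := K) E) n,
          pointsMap W E ((φ.1 u : geomTorsion W ((p ^ m : ℕ) : ℤ)) : geomPoints W) = u • R - R := by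
  set ι := closureEmb (K := K) E with hι
  obtain ⟨φ₀, rfl⟩ := oneCocycleClass_surjective _ c
  obtain ⟨φ', Q, k, hφ', hQ, hτ⟩ := (mem_localKummerOverOfEmb_iff _ _).mp hc
  rw [galoisCohomology.map_one_oneCocycleClass] at hφ'
  erw [map_oneCocycleClass] at hφ'
  rw [eq_comm] at hφ'
  have h0 := sub_eq_zero.mpr hφ'
  rw [← oneCocycleClass_sub] at h0
  obtain ⟨T₀, hT₀⟩ := (oneCocycleClass_eq_zero_iff _ _).mp h0
  -- the coboundary defect, read on points of `E(K̄_E)`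
  set T₀' : localPoints W E := pointsMapOfEmb W ι ((T₀ : geomPrimaryTorsion W p) : geomPoints W)
    with hT₀'
  have h1 : ∀ τ : localSubgroupOfEmb κ.kerSubgroup ι,
      pointsMapOfEmb W ι ((φ₀.1 (resGalOfEmb ι τ) : geomTorsion W _) : geomPoints W) -
        pointsMapOfEmb W ι ((φ'.1 (resGalSubgroupOfEmb κ.kerSubgroup ι τ) :
          geomPrimaryTorsion W p) : geomPoints W) =
      (τ : absoluteGaloisGroup E) • T₀' - T₀' := by
    intro τ
    have h := congrArg (fun z : geomPrimaryTorsion W p => pointsMapOfEmb W ι (z : geomPoints W))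
      (hT₀ (resGalSubgroupOfEmb κ.kerSubgroup ι τ))
    change pointsMapOfEmb W ι
        (((φ₀.1 (resGalOfEmb ι τ) : geomTorsion W _) : geomPoints W) -
          ((φ'.1 (resGalSubgroupOfEmb κ.kerSubgroup ι τ) : geomPrimaryTorsion W p) : geomPoints W)) =
      pointsMapOfEmb W ι
        (resGalOfEmb ι (τ : absoluteGaloisGroup E) • ((T₀ : geomPrimaryTorsion W p) : geomPoints W) -
          ((T₀ : geomPrimaryTorsion W p) : geomPoints W)) at h
    rw [map_sub, map_sub, pointsMapOfEmb_smul] at h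
    exact h
  -- the Kummer point seen by `φ₀` on `Gal(K̄_E/K_∞·E)`
  set Q' : localPoints W E := Q + T₀' with hQ'
  have h2 : ∀ τ : localSubgroupOfEmb κ.kerSubgroup ι,
      pointsMapOfEmb W ι ((φ₀.1 (resGalOfEmb ι τ) : geomTorsion W _) : geomPoints W) =
        (τ : absoluteGaloisGroup E) • Q' - Q' := by
    intro τ
    have h := h1 τ
    rw [hτ τ, sub_eq_iff_eq_add] at h
    rw [h, hQ', smul_add]
    abel
  -- the cocycle identity of `φ₀` on points
  have hcoc : ∀ a b : absoluteGaloisGroup K,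
      ((φ₀.1 (a * b) : geomTorsion W _) : geomPoints W) =
        ((φ₀.1 a : geomTorsion W _) : geomPoints W) + a • ((φ₀.1 b : geomTorsion W _) : geomPoints W) := by
    intro a b
    have h := congrArg (fun z : geomTorsion W ((p ^ m : ℕ) : ℤ) => (z : geomPoints W)) (φ₀.2 a b)
    simp only at h
    rw [AddMemClass.coe_add] at h
    exact h
  -- the defect crossed homomorphism `f(u) = ι(φ₀(u|_K̄)) − (uQ' − Q')`
  set f : absoluteGaloisGroup E → localPoints W E := fun u =>
    pointsMapOfEmb W ι ((φ₀.1 (resGalOfEmb ι u) : geomTorsion W _) : geomPoints W) - (u • Q' - Q')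
    with hf
  have hfcoc : ∀ u v : absoluteGaloisGroup E, f (u * v) = f u + u • f v := by
    intro u v
    simp only [hf]
    rw [map_mul, hcoc, map_add, pointsMapOfEmb_smul, mul_smul, smul_sub, smul_sub]
    abel
  have hfN : ∀ n ∈ localSubgroupOfEmb κ.kerSubgroup ι, f n = 0 := by
    intro n hn
    simp only [hf]
    rw [h2 ⟨n, hn⟩, sub_self]
  haveI : κ.kerSubgroup.Normal := MonoidHom.normal_ker _
  haveI hNn : (localSubgroupOfEmb κ.kerSubgroup ι).Normal := normal_localSubgroupOfEmb ι κ.kerSubgroup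
  have hfix : ∀ u : absoluteGaloisGroup E, f u ∈ localFixedPointsOfEmb ι W κ.kerSubgroup := by
    intro u
    rw [mem_localFixedPointsOfEmb_iff]
    intro n hn
    exact smul_eq_of_crossedHom_of_vanishing f hfcoc _ hfN u hn
  -- the layer `n₁` where `p^k Q` lives, and the exponent `j` killing `T₀`
  obtain ⟨n₁, hn₁⟩ := (mem_iSup_strictSignedLocalPointsOfEmb_iff κ ι W 1 _).mp hQ
  obtain ⟨j, hj⟩ := T₀.2
  have hjT : p ^ j • T₀' = 0 := by
    rw [hT₀', ← map_nsmul]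
    erw [hj]
    rw [map_zero]
  have hkQn : p ^ k • Q ∈ localLayerPointsOfEmb κ ι W n₁ :=
    strictSignedLocalPointsOfEmb_le_localLayerPoints κ ι W 1 n₁ hn₁
  have hkjQ' : p ^ (k + j) • Q' = p ^ j • (p ^ k • Q) := by
    rw [hQ', smul_add, pow_add, mul_comm, mul_nsmul', mul_nsmul', smul_comm (p ^ j) (p ^ k) T₀', hjT,
      smul_zero, add_zero]
  -- `f` vanishes on `Gal(K̄_E/K_{n₁}·E)`: its values are `p`-power torsion in `E(K_∞·E)`
  have hkey : ∀ u ∈ localLayerSubgroupOfEmb κ ι n₁,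
      pointsMapOfEmb W ι ((φ₀.1 (resGalOfEmb ι u) : geomTorsion W _) : geomPoints W) = u • Q' - Q' := by
    intro u hu
    have huQ : u • (p ^ (k + j) • Q') = p ^ (k + j) • Q' := by
      rw [hkjQ', smul_comm u (p ^ j) (p ^ k • Q), (mem_localLayerPointsOfEmb_iff κ ι W n₁ _).mp hkQn u hu]
    have htor : p ^ (m + (k + j)) • f u = 0 := by
      simp only [hf]
      rw [smul_sub, pow_add, mul_comm, mul_nsmul', ← map_nsmul, ← AddSubgroupClass.coe_nsmul,
        pow_nsmul_geomTorsion_eq_zero W p m, ZeroMemClass.coe_zero, map_zero, smul_zero, zero_sub,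
        neg_eq_zero, mul_comm, mul_nsmul', smul_sub, ← smul_comm u, huQ, sub_self, smul_zero]
    have h0 : f u = 0 := htorsInf (f u) (hfix u) _ htor
    simp only [hf] at h0
    exact sub_eq_zero.mp h0
  -- the point `x = p^m Q'` is a plus point of layer `n₁`
  have hxlayer : p ^ m • Q' ∈ localLayerPointsOfEmb κ ι W n₁ := by
    rw [mem_localLayerPointsOfEmb_iff]
    intro u hu
    have h := hkey u hu
    have h0 : p ^ m • (u • Q' - Q') = 0 := by
      rw [← h, ← map_nsmul, ← AddSubgroupClass.coe_nsmul, pow_nsmul_geomTorsion_eq_zero W p m,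
        ZeroMemClass.coe_zero, map_zero]
    rw [smul_sub, sub_eq_zero, smul_comm] at h0
    exact h0
  have hxstrict : p ^ m • Q' ∈ strictSignedLocalPointsOfEmb κ ι W 1 n₁ := by
    have hmem : p ^ (k + j) • (p ^ m • Q') ∈ strictSignedLocalPointsOfEmb κ ι W 1 n₁ := by
      rw [smul_comm, hkjQ']
      exact AddSubgroup.nsmul_mem _ (AddSubgroup.nsmul_mem _ hn₁ _) _
    rw [strictSignedLocalPointsOfEmb_one, signedLocalPointsOfEmb_eq_towerSigned] at hmem ⊢
    exact towerSignedLocalPointsOfEmb_saturated ι W κ.layerSubgroup κ.layerSubgroup_antitone 1 n₁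
      (noTorsion_pow (localLayerPointsOfEmb κ ι W n₁) (htors n₁) (k + j)) hxlayer hmem
  -- the representative of `res_E c`
  set ψE : contOneCocycles (DiscreteGaloisModule.toTopRep
      (GaloisRep.restrictField E (W.torsionGaloisModule ((p ^ m : ℕ) : ℤ)))) :=
    contOneCocycles.pullback (absGaloisRestrict K E)
      (Y := DiscreteGaloisModule.toTopRep
        (GaloisRep.restrictField E (W.torsionGaloisModule ((p ^ m : ℕ) : ℤ))))
      (TopRep.ofHom ⟨ContinuousLinearMap.id ℤ _, fun _ => rfl⟩) φ₀ with hψE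
  refine ⟨n₁, p ^ m • Q', hxstrict, Q', natCast_zsmul Q' (p ^ m), ψE, ?_, fun u hu ↦ ?_⟩
  · unfold galoisCohomology.res galoisCohomology.pullback
    erw [map_oneCocycleClass]
    rfl
  · change pointsMapOfEmb W ι ((φ₀.1 (absGaloisRestrict K E u) : geomTorsion W _) : geomPoints W) = _
    rw [← resGal_eq_absGaloisRestrict, resGal_eq, ← hι]
    exact hkey u hu

end Main

end Summit.BirchSwinnertonDyer.Rank1Residual.Additive.LevelBridge

/-! ## §2 (L0⁺) as a theorem -/

namespace Summit.BirchSwinnertonDyer.Rank1Residual.Additive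

open Summit.BirchSwinnertonDyer.Rank1Residual.Additive.LevelBridge ZpExtension

/-- **(L0⁺) — Kobayashi's (9.33) at `n = 0` for the sign `+`, on the quadratic branch, in
`W`-coordinates — is a THEOREM**: for `W/ℚ` globally minimal and ANY prime `p` (the statement's
binders: `p` odd, `C • W^{(p*)} = V` good with `a_p(V) = 0`, `κ` cyclotomic), every class of
`H¹(ℚ_0, W[p^∞])` whose image over `ℚ_∞` is Selmer and PLUS-Kummer at `ℚ_[p]` over the tower is
Kummer at `ℚ_[p]` at the bottom layer (`E⁺(ℚ_{0,p}) = W(ℚ_p)`): "For `v | p`, the kernel of `r_v`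
is zero by (9.33)" (proof of Thm. 9.3, p. 27). Proof: B3 in level-`m` shape (x1b file 98; Tate's
local Euler characteristic = the tree's theorem) + PLUS TRANSVERSALITY (`SignedTwistPlusTransverse`,
Prop. 8.12 ii)) in place of Kobayashi's Thm. 6.2; see the module docstring. UNCONDITIONAL.
[cite: Kobayashi2003, Prop. 9.2 with (9.30)/(9.33) and Thm. 9.3 (pp. 26–27), Thm. 6.2 (p. 11), Prop. 8.12 ii) (pp. 17–18), Prop. 8.7 (p. 16)]
[cite: GreenbergLNM1716, §3 pp. 85–86] [cite: MilneADT2006, Ch. I, Thm. 2.8 (p. 31)] -/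
theorem evenBranchPlusLocalControlZeroAt_holds (W : WeierstrassCurve ℚ) [W.IsElliptic]
    [W.IsGloballyMinimal] (p : ℕ) [hp : Fact p.Prime] : EvenBranchPlusLocalControlZeroAt W p := by
  intro V _ _ C hp2 hCV hgood hap κ hκ y hy
  set ι := closureEmb (K := ℚ) ℚ_[p] with hι
  -- (S1) `y = Ψ_m c` for some level `m` (`H¹(ℚ, W[p^∞])` is `p`-primary)
  obtain ⟨m, hmy⟩ : ∃ m : ℕ, p ^ m • y = 0 := by
    obtain ⟨x, rfl⟩ := (bijective_resH1Hom_subgroupIncl (geomPrimaryTorsion W p) (κ.layerSubgroup 0)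
      (mem_layerSubgroup_zero p κ)).surjective y
    obtain ⟨m, hm⟩ := exists_pow_nsmul_eq_zero_galH1Primary W p x
    exact ⟨m, by rw [← map_nsmul, hm, map_zero]⟩
  obtain ⟨c, rfl⟩ := exists_levelToLayerZero_eq_of_nsmul_eq_zero W p κ m
    W.zsmul_geomPoints_surjective_holds y hmy
  have hn0 : (((p ^ m : ℕ) : ℤ)) ≠ 0 := by exact_mod_cast pow_ne_zero m hp.out.ne_zero
  -- Tate's local Euler characteristic at `ℚ_[p]`, a theorem of the tree
  have hEPp : haveI : IsNonarchimedeanLocalField ℚ_[p] := Padic.isNonarchimedeanLocalField_holds p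
      localEulerPoincareCharacteristic ℚ_[p] := by
    haveI : IsNonarchimedeanLocalField ℚ_[p] := Padic.isNonarchimedeanLocalField_holds p
    exact localEulerPoincareCharacteristic_holds ℚ_[p]
  -- (htors) for the twist (x1b file 55), at `ℚ_[p]`
  obtain ⟨M₀, hΔ, hA, hVM₀⟩ := exists_goodSupersingularPadicModel hp2 V hgood hap
  have hsq := sq_ne_neg_one_pow_mul_prime hp.out (p / 2)
  have htorsE := eq_zero_of_prime_pow_smul_eq_zero_localFixedPointsOfEmb_kerSubgroup_of_quadraticTwist κ
    ι hp2 W hsq C hCV M₀ hΔ hA hVM₀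
  have htorsL : ∀ n', ∀ Q ∈ localLayerPointsOfEmb κ ι W n', p • Q = 0 → Q = 0 :=
    fun n' Q hQ hpQ ↦ htorsE Q
      (localFixedPointsOfEmb_antitone ι W (κ.kerSubgroup_le_layerSubgroup n') hQ) ⟨1, by rwa [pow_one]⟩
  have htorsInf : ∀ Q ∈ localFixedPointsOfEmb ι W κ.kerSubgroup, ∀ j : ℕ, p ^ j • Q = 0 → Q = 0 :=
    fun Q hQ j hj ↦ htorsE Q hQ ⟨j, hj⟩
  -- the good supersingular `ℤ_p`-model in the Honda–Kobayashi binders, and `ℚ(μ_p)`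
  obtain ⟨M, hM1, hM2, htr, hVM⟩ := exists_padicModel_tr_eq_zero V hgood hap
  haveI := hM1
  haveI := hM2
  haveI : NeZero p := ⟨hp.out.ne_zero⟩
  haveI hcycF : IsCyclotomicExtension {p} ℚ (CyclotomicField p ℚ) := by
    have h : (CyclotomicField.algebra p ℚ : Algebra ℚ (CyclotomicField p ℚ)) = DivisionRing.toRatAlgebra :=
      Subsingleton.elim _ _
    exact h ▸ CyclotomicField.isCyclotomicExtension p ℚ
  -- (S2) the plus component of `hy` at `σ = 1`, in `h_0`-form
  have hc1 : resH1Hom (Literature.NumberTheory.EllipticCurves.subgroupIncl κ.kerSubgroup) (AddMonoidHom.id (geomPrimaryTorsion W p))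
      (fun _ _ ↦ rfl) (galoisCohomology.map (primaryInclusion W p m) 1 c) ∈
      localKummerOverOfEmb W p κ.kerSubgroup ι (⨆ n, strictSignedLocalPointsOfEmb κ ι W 1 n) := by
    have h := (AddSubgroup.mem_iInf.mp (AddSubgroup.mem_inf.mp (AddSubgroup.mem_comap.mp hy)).2) 1
    rw [AddSubgroup.mem_comap, W.conjH1_one_holds p κ.kerSubgroup, AddMonoidHom.id_apply,
      layerToInfty_levelToLayerZero_eq] at h
    exact h
  -- (S3) a plus Kummer witness `(x, R, φ)` for `res_p c` at some layer `n₁` (§1)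
  obtain ⟨n₁, x, hx, R, hR, φ, hφ, hφu⟩ :=
    exists_kummer_cocycle_of_mem_localKummerOverOfEmb_iSup_signed_one W p m ℚ_[p] κ htorsL htorsInf c hc1
  -- (S4) B3 at the layer `n = max (2m) n₁`: `Σ_m ⊔ 𝓚 = ⊤`
  obtain ⟨hsup, -, -, -⟩ :=
    SignedTwist.closure_minus_sup_range_localKummerMap_eq_top_of_localEuler W κ (CyclotomicField p ℚ)
      hp2 hκ C hCV M htr hVM (show 2 * m ≤ max (2 * m) n₁ + 1 by omega) hEPp
  have hmem := (AddSubgroup.eq_top_iff' _).mp hsup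
    (galoisCohomology.res (W.torsionGaloisModule ((p ^ m : ℕ) : ℤ)) ℚ_[p] 1 c)
  -- the plus witness moved up to the layer `n`
  have hx1 : x ∈ signedLocalPointsOfEmb κ ι W 1 (max (2 * m) n₁) :=
    signedLocalPointsOfEmb_mono κ ι W 1 (le_max_right _ _) (strictSignedLocalPointsOfEmb_le κ ι W 1 n₁ hx)
  -- (S5) plus transversality: `res_p c ∈ 𝓚`
  have hK := SignedTwist.mem_range_localKummerMap_of_plus_of_mem_sup_cyclotomic W κ (CyclotomicField p ℚ)
    hp2 hκ C hCV M htr hVM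
    ⟨x, hx1, R, hR, φ, hφ.symm, fun u hu ↦ hφu u (localLayerSubgroupOfEmb_antitone κ ι (le_max_right _ _) hu)⟩
    hmem
  -- (S6) `res_p c` is the Kummer class of a point `Q ∈ W(ℚ_p) = E⁺(ℚ_{0,p})`: `y` is plus-Kummer at level `0`
  obtain ⟨Q, hQ, R', hR', φ', hφ', hφ'u⟩ := SignedTwist.exists_kummer_cocycle_of_mem_range_localKummerMap W κ m hK
  have hR'A : p ^ m • R' ∈ strictSignedLocalPoints κ ℚ_[p] W 1 0 := by
    change p ^ m • R' ∈ strictSignedLocalPointsOfEmb κ ι W 1 0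
    rw [← natCast_zsmul, hR', strictSignedLocalPointsOfEmb_one, signedLocalPointsOfEmb_zero]
    exact hQ
  exact resH1Hom_subgroupIncl_map_mem_localKummerOverOfEmb_of_res_eq W p m ℚ_[p] (κ.layerSubgroup 0) _ c φ'
    hφ'.symm hR'A le_rfl (fun u _ ↦ hφ'u u)

namespace EvenControlZero

variable (W : WeierstrassCurve ℚ) [W.IsElliptic] [W.IsGloballyMinimal] (p : ℕ) [hp : Fact p.Prime]

/-! ## §3 File 5's two inequalities with (L0⁺) discharged -/

open scoped MatrixGroups ModularForm in
open CongruenceSubgroup Literature.NumberTheory.EllipticCurves.ModularForms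
  Literature.NumberTheory.EllipticCurves.Rank1Residual Literature.NumberTheory.EllipticCurves.IwasawaAlgebra in
/-- **T-e2-r0, BOTH INEQUALITIES, modulo (R1⁺) + (R2⁺) only** ((L0⁺) = Kobayashi (9.33) is now
`evenBranchPlusLocalControlZeroAt_holds`): for `W` globally minimal, `p ≥ 5`, the good `a_p = 0`
twin `V` with (C1_η), its newform `f`, the period ratio `ϖ` and ANY `L` with
`IsQuadraticBranchPlusLFunction f p ϖ L`, `L(0) ≠ 0`: `Sel_{p^∞}(W/ℚ)` is finite,
`ord_p #Sel_{p^∞}(W/ℚ) ≤ v_p(L(0))` and `v_p(L(0)) ≤ ord_p #Sel_{p^∞}(W/ℚ) + ord_p(Tam(W)/#W(ℚ)_tors²)`.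
CONDITIONAL on the two readings (C1_η read on the `W`-coordinate plus dual data; Kitajima–Otsuki
sign `+`) and (C1_η); nothing booked. [cite: Kobayashi2003, §4 (p. 8), Thm. 9.3 with (9.33) (pp. 26–27)]
[cite: KitajimaOtsuki2018, Main Thm. 1.3 (arXiv:1607.03612 p. 3)]
[cite: GreenbergLNM1716, §3 Lemma 3.3, §4 Thm. 4.1 and Lemma 4.2 (p. 102)] -/
theorem finite_and_padicValNat_card_selmerGroupPInfty_le_and_le_of_readings'
    (hR1 : EvenBranchPlusCharIdealOfPlusMCAt W p) (hR2 : EvenBranchPlusNoFiniteSubmoduleAt W p)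
    (V : WeierstrassCurve ℚ) [V.IsElliptic] [V.IsGloballyMinimal] (C : VariableChange ℚ)
    {N : ℕ} [NeZero N] {f : CuspForm (Gamma0 N) 2}
    (hp5 : 5 ≤ p) (hCV : C • W.quadraticTwist ((-1) ^ (p / 2) * p) = V)
    (hgood : V.HasGoodReductionAtPrime p) (hap : V.frobeniusTrace p = 0)
    (h1 : QuadraticBranchPlusMainConjectureAt V p) (hf : IsNewformOf V f) {ϖ : ℚ}
    (hϖ : if Even (p / 2) then (ϖ : ℝ) * V.realPeriodRat = plusPeriod f
      else (ϖ : ℝ) * V.imaginaryPeriodRat = minusPeriod f)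
    {L : IwasawaAlgebra p} (hL : IsQuadraticBranchPlusLFunction f p ϖ L)
    (h0 : PowerSeries.constantCoeff L ≠ 0) :
    Finite ↥(W.selmerGroupPInfty p) ∧
      (padicValNat p (Nat.card ↥(W.selmerGroupPInfty p)) : ℤ) ≤
        ((PowerSeries.constantCoeff L : ℤ_[p]) : ℚ_[p]).valuation ∧
      ((PowerSeries.constantCoeff L : ℤ_[p]) : ℚ_[p]).valuation ≤
        (padicValNat p (Nat.card ↥(W.selmerGroupPInfty p)) : ℤ) +
          padicValRat p ((W.tamagawaProduct : ℚ) / (W.torsionOrder : ℚ) ^ 2) :=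
  finite_and_padicValNat_card_selmerGroupPInfty_le_and_le_of_readings W p hR1 hR2
    (evenBranchPlusLocalControlZeroAt_holds W p) V C hp5 hCV hgood hap h1 hf hϖ hL h0

/-! ## §4 The TYPED T-e2-r0 node on the Tamagawa-free rows -/

open scoped MatrixGroups ModularForm in
open CongruenceSubgroup Literature.NumberTheory.EllipticCurves.ModularForms
  Literature.NumberTheory.EllipticCurves.Rank1Residual Literature.NumberTheory.EllipticCurves.IwasawaAlgebra in
/-- **T-e2-r0 — the typed node `QuadraticBranchEvenExactControlOfPlusMCAt W p` — HOLDS on every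
Tamagawa-free row (`p ∤ Tam(W)`), modulo (R1⁺) + (R2⁺)**: there `ord_p(Tam(W)/#W(ℚ)_tors²) = 0`
(`p ∤ #W(ℚ)_tors` since `W(ℚ_p)[p] = 0`), and §3's two inequalities
`ord_p #Sel ≤ v_p(L(0)) ≤ ord_p #Sel + 0` close up to the EXACT formula. (For `p ∣ Tam(W)` the
equality is the rank-`0` Cassels–Poitou–Tate count, sequel.) CONDITIONAL on the two readings and
(C1_η) (inside the node); nothing booked.
[cite: Kobayashi2003, §4 (p. 8), Thm. 9.3 with (9.33) (pp. 26–27)]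
[cite: KitajimaOtsuki2018, Main Thm. 1.3 (arXiv:1607.03612 p. 3)] [cite: GreenbergLNM1716, §4 Thm. 4.1] -/
theorem quadraticBranchEvenExactControlOfPlusMCAt_of_readings_of_not_dvd_tamagawa
    (hR1 : EvenBranchPlusCharIdealOfPlusMCAt W p) (hR2 : EvenBranchPlusNoFiniteSubmoduleAt W p)
    (htam : ¬ p ∣ W.tamagawaProduct) : QuadraticBranchEvenExactControlOfPlusMCAt W p := by
  intro V _ _ C N _ f hp5 hCV hgood hap h1 hf ϖ hϖ L hL h0
  have hp2 : p ≠ 2 := by omega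
  obtain ⟨hfin, hle, hge⟩ := finite_and_padicValNat_card_selmerGroupPInfty_le_and_le_of_readings' W p hR1
    hR2 V C hp5 hCV hgood hap h1 hf hϖ hL h0
  -- `ord_p(Tam(W)/#tors²) = 0`
  have htors := eq_zero_of_prime_smul_eq_zero_padic_of_quadraticTwist_goodSupersingular hp2 W C V hCV hgood hap
  have htors0 := LevelBridge.padicValNat_torsionOrder_eq_zero_of_noPTorsion W p htors
  have hTamQ : (W.tamagawaProduct : ℚ) ≠ 0 := by exact_mod_cast W.tamagawaProduct_pos_holds.ne'
  have htQ : (W.torsionOrder : ℚ) ≠ 0 := by exact_mod_cast W.torsionOrder_pos_holds.ne'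
  have hrat : padicValRat p ((W.tamagawaProduct : ℚ) / (W.torsionOrder : ℚ) ^ 2) = 0 := by
    rw [padicValRat.div hTamQ (pow_ne_zero 2 htQ), padicValRat.pow, padicValRat.of_nat, padicValRat.of_nat,
      htors0, padicValNat.eq_zero_of_not_dvd htam]
    simp
  rw [hrat] at hge ⊢
  refine ⟨hfin, le_antisymm ?_ ?_⟩
  · simpa using hle
  · simpa using hge

end EvenControlZero

end Summit.BirchSwinnertonDyer.Rank1Residual.Additive

end
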